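import Summits.Ventures.MM22.Rank333.ProfileCertSub
import Summits.Ventures.MM22.Rank333.GF2ProfileSymmetrySub
import HarnessLib

/-!
# MM22 venture — PROFILE-CERT kernel replay: sub-instances WITH S-nodes (symmetry of the set-form predicate)

HONEST FRAMING (cell `pub-mm22`, seat p1 g5; V4-MENU item (0′)). Checker PLUMBING: for a sub-instance `S` the set-form validity predicate
`VSet S N` is invariant under every listed generator that has inverse witnesses and FIXES `S` (`fixesB`, raw action — p2's `invcomp`
certificates), via LIT-2's `cert_preimRow_sub_pull{B,TB}_raw` (GF2ProfileSymmetrySub). `noExt_of_chunk_sub` is the per-chunk corollary the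
data files of such certificates use. LANDS AFTER `GF2ProfileSymmetrySub`. No bound is claimed here; no summit claim.
-/

set_option autoImplicit false

namespace Summit.Ventures.MM22.ProfileCert

/-! # Part 6 — sub-instances WITH S-nodes: symmetry of `VSet` under generators fixing `S` (raw action) -/

section SubSym
open Summit.MatrixMultiplication.OmegaCensus.GF2RankLB Summit.Ventures.MM22.GF2Cert.Profile Matrix
  Literature.Computability.AlgebraicComplexity

/-- Certificate transport relative to `S` along a listed generator that fixes `S` (raw action, both kinds). -/
theorem cert_preimRow_sigma {S : List ℕ} {mp : MapW} (hinv : mp.invOK = true) (hfix : fixesB S mp.sigma = true)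
    {L : List ℕ} {b : ℕ} (h : Cert 3 3 3 (S ++ L) b) : Cert 3 3 3 (S ++ preimRow 3 3 mp.sigma L) b := by
  obtain ⟨r1, _, _, r4⟩ := MapW.invOK_raw hinv
  by_cases ht : mp.t = 1
  · have hσ : mp.sigma = pullTB 3 mp.Q mp.P := by
      funext x; unfold MapW.sigma; rw [ht]; exact sigma_eq_pullTB _ _ _
    rw [hσ] at hfix ⊢
    exact cert_preimRow_sub_pullTB_raw (l := 3) (n := 3) r4 r1 (fixes_of_fixesB hfix) h
  · have hσ : mp.sigma = pullB 3 3 (tr3 mp.P) (tr3 mp.Q) := by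
      funext x; unfold MapW.sigma; rw [← sigma_eq_pullB]; unfold sigma; rw [if_neg ht]; rfl
    rw [hσ] at hfix ⊢
    exact cert_preimRow_sub_pullB_raw (l := 3) (m := 3) (n := 3) (mulBits_tr3_tr3_eq_one r1) (mulBits_tr3_tr3_eq_one r4)
      (fixes_of_fixesB hfix) h

/-- **Symmetry of the set-form validity predicate** under every listed generator that has inverse witnesses and fixes `S`:
what `noExt_of_chunk_maps` needs for sub-instance certificates WITH S-nodes (raw-action generators, p2's `invcomp` files). -/
theorem symOKL_vset {S : List ℕ} {N : ℕ} {maps : List MapW} (hfix : (maps.all fun mp => fixesB S mp.sigma) = true) :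
    SymOKL (VSet S N) maps := by
  classical
  rw [List.all_eq_true] at hfix
  intro mp hmp hinv M hM
  obtain ⟨hc, hsub, hrows⟩ := hM
  have hb := bijOn_of_invOK hinv
  have hinj : Set.InjOn mp.sigma ↑M := hb.injOn.mono fun x hx => Finset.mem_coe.2 (hsub (Finset.mem_coe.1 hx))
  refine ⟨?_, ?_, ?_⟩
  · rw [Finset.card_image_of_injOn hinj, hc]
  · intro y hy
    obtain ⟨x, hx, rfl⟩ := Finset.mem_image.1 hy
    exact hb.mapsTo (Finset.mem_coe.2 (hsub hx))
  · intro L b hC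
    have key := hrows (preimRow 3 3 mp.sigma L) b (cert_preimRow_sigma hinv (hfix mp hmp) hC)
    have hle : ((M.image mp.sigma).filter fun f => f ∈ L).card ≤ (M.filter fun f => f ∈ preimRow 3 3 mp.sigma L).card := by
      have heq : ((M.image mp.sigma).filter fun f => f ∈ L) = (M.filter fun f => f ∈ preimRow 3 3 mp.sigma L).image mp.sigma := by
        ext y
        simp only [Finset.mem_filter, Finset.mem_image]
        constructor
        · rintro ⟨⟨x, hx, rfl⟩, hL⟩
          refine ⟨x, ⟨hx, mem_preimRow.2 ⟨?_, hL⟩⟩, rfl⟩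
          have := mem_forms.1 (hsub hx); rw [NF] at this; omega
        · rintro ⟨x, ⟨hx, hpre⟩, rfl⟩
          exact ⟨⟨x, hx, rfl⟩, (mem_preimRow.1 hpre).2⟩
      rw [heq]
      exact Finset.card_image_le
    omega

/-- Boolean side condition for a whole certificate tree: every listed generator fixes `S`. -/
def PC.fixesAllB (S : List ℕ) (t : PC) : Bool := t.maps.all fun mp => fixesB S mp.sigma

/-- **Per-chunk corollary for sub-instances WITH S-nodes.** -/
theorem noExt_of_chunk_sub {S : List ℕ} {N : ℕ} {rt : RT} (hrt : ∀ i, RowCertS S N (rt.get i)) {refs : List Entry}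
    (hrefs : RefsOK (VSet S N) refs) {t : PC} {s : St} (hfix : t.fixesAllB S = true) (ht : t.isChain = false)
    (hwf : s.wfB = true) (h : check rt N refs t s = true) : NoExt (VSet S N) s :=
  noExt_of_chunk_maps (vhyp0_set hrt) hrefs (symOKL_vset hfix) ht hwf h

end SubSym

end Summit.Ventures.MM22.ProfileCert
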